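import Summits.CriticalPhenomena.Ising3DConformalLimit.Theorems.HyperoctahedralRPLimitRotationInvariantLimitRegularity
import Summits.CriticalPhenomena.Ising3DConformalLimit.Theorems.HyperoctahedralRPLimitRotationInvariantInPlaneLightCone
import Literature.MathematicalPhysics.QuantumFieldTheory.MirrorSlabTranslationHolomorphy
import Literature.MathematicalPhysics.QuantumFieldTheory.LatticeNormalsThreeGoodDirections
import Literature.Analysis.Complex.LocalCrossTheorem
import HarnessLib

/-!
# Crux `RotationUpgradeFromTwoPoint` (stmt-CriticalPhenomena-8367), line `null-laplacian-edge-gaussianity`: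
# STUB 3 `stub_analyticOffFinite` — the correlation functions of the limit are real-analytic in one
# point off a finite set

Statement (registered stub, proved by name below).  For every normalised, non-degenerate,
translation-invariant, scale-covariant pointwise scaling limit `S` of the critical Ising
correlators `criticalCorr 3` (`ρ > 0` on `(0,1]`) with nine-mirror Osterwalder–Schrader positivity of
all orders, and every injective `y : Fin m → ℝ³`, there is a FINITE set `F ⊆ ℝ³` such that
`x ↦ S_{m+1}(x, y)` is real-analytic (`AnalyticOnNhd ℝ`) on the complement of `range y ∪ F`.

Proof (Glimm–Jaffe §6.1 + Bernstein's cross theorem; all analysis in the tree).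
* `LimitRegularity` (landed `QuarterTurnLiouville.stub_limitRegularity`: permutation symmetry,
  translation invariance, continuity off the diagonals, …) and the nine-mirror RP hypothesis give
  `LimitStructure`, hence the in-plane light cone `QuarterTurnLiouville.stub_inPlaneLightCone`
  (with `Literature.Analysis.Complex.DiamondCross_holds`); its `y = 0` section is, for every
  lattice normal `n`, the half-plane holomorphy of the two-cluster functions of the mirror `n^⊥`
  in the normal translation (`halfPlaneHolomorphy_of_inPlaneLightCone`, a `B₂` partner `n'` of `n`
  always exists: `exists_B2Partner`).
* the one-mirror lemma `Literature.MathematicalPhysics.QuantumFieldTheory.eventually_exists_halfPlane_extension_slabShift`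
  (inlined here in the two spanning directions `(1,1)`, `(0,1)` of the `(t,s)`-plane + the
  local cross theorem): for a lattice normal `n` GOOD at `x` (the height `⟪x, n⟫` avoids the
  heights `⟪y i, n⟫`), `t ↦ S_{m+1}(x' + t n, y)` extends to a fixed complex disc with a fixed
  bound, uniformly for `x'` near `x`.
* `Literature.MathematicalPhysics.QuantumFieldTheory.exists_finset_three_good_latticeNormals`
  (any five of the nine normals span `ℝ³`): off a finite set `F`, every `x` has three linearly
  independent good lattice normals `n₁, n₂, n₃`.
* `Literature.Analysis.Complex.exists_holomorphic_extension_of_separately_three_local` (the local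
  cross theorem in three variables): `(t₁,t₂,t₃) ↦ S_{m+1}(x + Σ tₖ nₖ, y)` extends holomorphically
  near `0 ∈ ℂ³`; the chart lemma `Literature.Analysis.Complex.analyticAt_of_holomorphic_chart`
  (Osgood, restriction of scalars, the affine chart `w ↦ coordinates of w - x in the basis nₖ`)
  gives analyticity of `S_{m+1}(·, y)` at `x`.

References: J. Glimm, A. Jaffe, *Quantum Physics* (1987), §6.1 Thm. 6.1.3; K. Osterwalder,
R. Schrader, Comm. Math. Phys. 42 (1975), §4; M. Jarnicki, P. Pflug, *Separately Analytic
Functions* (EMS 2011), Ch. 5.  No definitions are introduced.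
-/

noncomputable section

open scoped InnerProductSpace BigOperators
open Filter Topology Set Metric
open Literature.Probability.LatticeModels
open Literature.MathematicalPhysics.QuantumFieldTheory
open Literature.Analysis.Complex
open Summit.CriticalPhenomena.Ising3DConformalLimit.Cruxes.LimitRotationInvariant

namespace Summit.CriticalPhenomena.Ising3DConformalLimit.Cruxes.RotationUpgradeFromTwoPoint.NullLaplacianEdgeGaussianity

/-! ### A `B₂` partner and the half-plane holomorphy of the two-cluster functions -/

/-- Equal squared norms give equal norms. -/
theorem norm_eq_of_sq_eq {a b : EuclideanSpace ℝ (Fin 3)} (h : ‖a‖ ^ 2 = ‖b‖ ^ 2) : ‖a‖ = ‖b‖ :=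
  (sq_eq_sq₀ (norm_nonneg _) (norm_nonneg _)).1 h

/-- **Every lattice mirror normal of `ℤ³` has a `B₂` partner**: an orthogonal lattice mirror normal
of the same length (`e_i ↦ e_j`, `e_i ± e_j ↦ e_i ∓ e_j`). -/
theorem exists_B2Partner {n : EuclideanSpace ℝ (Fin 3)} (hn : n ∈ latticeMirrorNormals (Fin 3)) :
    ∃ n' ∈ latticeMirrorNormals (Fin 3), ⟪n, n'⟫_ℝ = 0 ∧ ‖n‖ = ‖n'‖ := by
  obtain ⟨i, j, hij, rfl | rfl | rfl⟩ := hn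
  · refine ⟨EuclideanSpace.single j 1, single_mem_latticeMirrorNormals hij.symm, ?_, ?_⟩
    · rw [inner_single_one_left, single_apply_eq_ite, if_neg hij]
    · rw [norm_single_one, norm_single_one]
  · refine ⟨EuclideanSpace.single i 1 - EuclideanSpace.single j 1,
      single_sub_single_mem_latticeMirrorNormals hij, ?_, ?_⟩
    · rw [inner_single_add_single_left]
      simp [hij, hij.symm]
    · exact norm_eq_of_sq_eq (by rw [norm_sq_single_add_single hij, norm_sq_single_sub_single hij])
  · refine ⟨EuclideanSpace.single i 1 + EuclideanSpace.single j 1,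
      single_add_single_mem_latticeMirrorNormals hij, ?_, ?_⟩
    · rw [inner_single_sub_single_left]
      simp [hij, hij.symm]
    · exact norm_eq_of_sq_eq (by rw [norm_sq_single_add_single hij, norm_sq_single_sub_single hij])

/-- **The `y = 0` section of the in-plane light cone**: for every lattice mirror normal `n`, the
two-cluster functions `t ↦ S(θ_n A ⊔ (B + t n))` of single clusters `A`, `B` in the open half-space
are restrictions of functions holomorphic on `{Re t > 0}` with the Gram bound
`‖Φ‖² ≤ S(θA ⊔ A) S(θB ⊔ B)` (Glimm–Jaffe Thm. 6.1.3 in the form consumed by the Literature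
one-mirror lemma). -/
theorem halfPlaneHolomorphy_of_inPlaneLightCone {S : CorrFamily 3}
    (hIP : QuarterTurnLiouville.InPlaneLightCone S) {n : EuclideanSpace ℝ (Fin 3)}
    (hn : n ∈ latticeMirrorNormals (Fin 3)) :
    ∀ (k : ℕ) (A : Fin k → EuclideanSpace ℝ (Fin 3)) (k' : ℕ)
      (B : Fin k' → EuclideanSpace ℝ (Fin 3)), (∀ a, 0 < ⟪A a, n⟫_ℝ) → (∀ b, 0 < ⟪B b, n⟫_ℝ) →
      ∃ Φ : ℂ → ℂ, DifferentiableOn ℂ Φ {t : ℂ | 0 < t.re} ∧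
        (∀ t : ℝ, 0 < t → Φ t = ((S (k + k')
          (Fin.append (fun a => (ℝ ∙ n)ᗮ.reflection (A a)) (fun b => B b + t • n)) : ℝ) : ℂ)) ∧
        ∀ t : ℂ, 0 < t.re → ‖Φ t‖ ^ 2 ≤
          S (k + k) (Fin.append (fun a => (ℝ ∙ n)ᗮ.reflection (A a)) A) *
          S (k' + k') (Fin.append (fun b => (ℝ ∙ n)ᗮ.reflection (B b)) B) := by
  intro k A k' B hA hB
  obtain ⟨n', hn', horth, hlen⟩ := exists_B2Partner hn
  obtain ⟨G, hGd, hGr, hGb⟩ := hIP n hn n' hn' horth hlen 1 (fun _ => k) (fun _ => A) (fun _ => 1)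
    1 (fun _ => k') (fun _ => B) (fun _ => 1) (fun _ i => hA i) (fun _ j => hB j)
  have hmaps : MapsTo (fun t : ℂ => (t, (0 : ℂ))) {t : ℂ | 0 < t.re} QuarterTurnLiouville.coneTube :=
    fun t ht => by simpa [QuarterTurnLiouville.coneTube] using ht
  refine ⟨fun t => G (t, 0), hGd.comp (differentiableOn_id.prodMk (differentiableOn_const _)) hmaps,
    fun t ht => ?_, fun t ht => ?_⟩
  · have h := hGr t 0 ht
    simp only [Finset.univ_unique, Fin.default_eq_zero, Finset.sum_singleton, one_mul, zero_smul,
      add_zero, Complex.ofReal_zero] at h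
    exact h
  · have h := hGb (t, 0) (hmaps ht)
    simp only [Finset.univ_unique, Fin.default_eq_zero, Finset.sum_singleton, one_mul] at h
    exact h

/-! ### The stub -/

/-- **STUB 3 of line `null-laplacian-edge-gaussianity` — `stub_analyticOffFinite`** (the reusable
regularity layer, valid for every `Δ` in the window).  For every normalised, non-degenerate,
translation-invariant, scale-covariant pointwise scaling limit `S` of `criticalCorr 3` (`ρ > 0` on
`(0,1]`) with nine-mirror Osterwalder–Schrader positivity of all orders, and every injective
`y : Fin m → ℝ³`, the function `x ↦ S_{m+1}(x, y)` is real-analytic off `range y ∪ F` for a finite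
set `F`.  Proof: Glimm–Jaffe §6.1 holomorphy of the two-cluster functions of each lattice mirror
(in-plane light cone at `y = 0`), the one-mirror lemma in two spanning directions and Bernstein's
cross theorem (directional analyticity for every good lattice normal, locally uniformly), the
counting fact that any five of the nine normals span `ℝ³` (three independent good directions off a
finite set), and the local cross theorem in three variables. -/
theorem stub_analyticOffFinite :
    ∀ (ρ : ℝ → ℝ) (Δ : ℝ) (S : CorrFamily 3), (∀ δ ∈ Set.Ioc (0:ℝ) 1, 0 < ρ δ) →
      HasPointwiseScalingLimit (criticalCorr 3) ρ S →
      (∀ n z, z ∉ NonCoincident 3 n → S n z = 0) → IsNondegenerateTwoPoint S →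
      IsTranslationInvariant S → IsScaleCovariant Δ S →
      (∀ n : EuclideanSpace ℝ (Fin 3),
        (∃ i j : Fin 3, i ≠ j ∧ (n = EuclideanSpace.single i 1 ∨
          n = EuclideanSpace.single i 1 + EuclideanSpace.single j 1 ∨
          n = EuclideanSpace.single i 1 - EuclideanSpace.single j 1)) →
        ∀ (k : ℕ) (m : Fin k → ℕ) (A : (a : Fin k) → Fin (m a) → EuclideanSpace ℝ (Fin 3))
          (c : Fin k → ℝ), (∀ a i, 0 < inner ℝ (A a i) n) →
          0 ≤ ∑ a, ∑ b, c a * c b *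
            S (m a + m b) (Fin.append (fun i => ((ℝ ∙ n)ᗮ).reflection (A a i)) (A b))) →
      ∀ (m : ℕ) (y : Fin m → EuclideanSpace ℝ (Fin 3)), Function.Injective y →
        ∃ F : Finset (EuclideanSpace ℝ (Fin 3)),
          AnalyticOnNhd ℝ (fun x : EuclideanSpace ℝ (Fin 3) => S (m + 1) (Fin.cons x y))
            (Set.range y ∪ (F : Set (EuclideanSpace ℝ (Fin 3))))ᶜ := by
  intro ρ Δ S hρ hlim hnorm hnd htr hsc hRP m y hy
  -- the landed structure of the limit
  have hreg : QuarterTurnLiouville.LimitRegularity Δ S :=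
    QuarterTurnLiouville.stub_limitRegularity ρ Δ S ⟨hρ, hlim, hnorm, hnd, htr, hsc⟩
  have hnine : QuarterTurnLiouville.NineMirrorRP S := fun n hn => hRP n hn
  have hL : QuarterTurnLiouville.LimitStructure Δ S := ⟨hreg, hnine⟩
  have hIP : QuarterTurnLiouville.InPlaneLightCone S :=
    QuarterTurnLiouville.stub_inPlaneLightCone Literature.Analysis.Complex.DiamondCross_holds Δ S hL
  obtain ⟨-, -, -, -, -, -, hperm, -, hcont⟩ := hreg
  -- the finite exceptional set
  obtain ⟨F, hF⟩ := exists_finset_three_good_latticeNormals y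
  refine ⟨F, fun x hx => ?_⟩
  rw [Set.mem_compl_iff, Set.mem_union, not_or] at hx
  obtain ⟨hxy, hxF⟩ := hx
  obtain ⟨n₁, n₂, n₃, hn₁, hn₂, hn₃, hli, hg₁, hg₂, hg₃⟩ := hF x hxF
  -- the base configuration
  set z₀ : Fin (m + 1) → EuclideanSpace ℝ (Fin 3) := Fin.cons x y with hz₀
  have hz₀inj : Function.Injective z₀ := Fin.cons_injective_iff.2 ⟨hxy, hy⟩
  have hgood : ∀ {n : EuclideanSpace ℝ (Fin 3)}, (∀ i, ⟪y i, n⟫_ℝ ≠ ⟪x, n⟫_ℝ) →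
      ∀ j : Fin (m + 1), j ≠ 0 → ⟪z₀ j, n⟫_ℝ ≠ ⟪z₀ 0, n⟫_ℝ := by
    intro n hg j hj
    obtain ⟨i, rfl⟩ := Fin.exists_succ_eq.2 hj
    simpa [hz₀] using hg i
  -- positive margins below/above finitely many strict inequalities
  have margin_lt : ∀ {p : Fin (m + 1) → Prop} {f : Fin (m + 1) → ℝ} {c : ℝ},
      (∀ j, p j → f j < c) → ∃ g > 0, ∀ j, p j → f j < c - g := by
    intro p f c h
    have hev : ∀ᶠ g in 𝓝 (0 : ℝ), ∀ j, p j → f j < c - g := by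
      refine Filter.eventually_all.2 fun j => ?_
      by_cases hj : p j
      · have hc : ContinuousAt (fun g : ℝ => c - g) 0 :=
          (continuous_const.sub continuous_id).continuousAt
        have : f j < c - 0 := by simpa using h j hj
        exact (continuousAt_const.eventually_lt hc this).mono fun g hg _ => hg
      · exact Filter.Eventually.of_forall fun g h' => absurd h' hj
    obtain ⟨g, hg, hg0⟩ := ((hev.filter_mono nhdsWithin_le_nhds).and
      (self_mem_nhdsWithin : Set.Ioi (0 : ℝ) ∈ 𝓝[>] (0 : ℝ))).exists
    exact ⟨g, hg0, hg⟩
  have margin_gt : ∀ {p : Fin (m + 1) → Prop} {f : Fin (m + 1) → ℝ} {c : ℝ},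
      (∀ j, p j → c < f j) → ∃ g > 0, ∀ j, p j → c + g < f j := by
    intro p f c h
    obtain ⟨g, hg, hlt⟩ := margin_lt (p := p) (f := fun j => -f j) (c := -c)
      fun j hj => by linarith [h j hj]
    exact ⟨g, hg, fun j hj => by linarith [hlt j hj]⟩
  -- moving two index blocks along a vector costs at most `(|u| + |v|) ‖n‖` in the sup distance
  have dist_shift : ∀ {n : EuclideanSpace ℝ (Fin 3)} (J₀ J : Finset (Fin (m + 1)))
      (z : Fin (m + 1) → EuclideanSpace ℝ (Fin 3)) (u v : ℝ),
      dist (fun j => z j + (if j ∈ J₀ then u else 0) • n + (if j ∈ J then v else 0) • n) z ≤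
        (|u| + |v|) * ‖n‖ := by
    intro n J₀ J z u v
    refine (dist_pi_le_iff (by positivity)).2 fun j => ?_
    rw [dist_eq_norm, add_assoc, add_sub_cancel_left]
    refine (norm_add_le _ _).trans ?_
    rw [norm_smul, norm_smul, Real.norm_eq_abs, Real.norm_eq_abs, add_mul]
    have hu : |(if j ∈ J₀ then u else 0)| ≤ |u| := by split_ifs <;> simp
    have hv : |(if j ∈ J then v else 0)| ≤ |v| := by split_ifs <;> simp
    exact add_le_add (mul_le_mul_of_nonneg_right hu (norm_nonneg _))
      (mul_le_mul_of_nonneg_right hv (norm_nonneg _))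
  -- directional analyticity along the three good normals, locally uniformly
  have hdir : ∀ {n : EuclideanSpace ℝ (Fin 3)}, n ∈ latticeMirrorNormals (Fin 3) →
      (∀ i, ⟪y i, n⟫_ℝ ≠ ⟪x, n⟫_ℝ) →
      ∃ r > 0, ∃ M : ℝ, ∀ᶠ z in 𝓝 z₀, ∃ g : ℂ → ℂ, DifferentiableOn ℂ g (ball (0 : ℂ) r) ∧
        (∀ w ∈ ball (0 : ℂ) r, ‖g w‖ ≤ M) ∧
        ∀ t : ℝ, |t| < r → g t = ((S (m + 1) (Function.update z 0 (z 0 + t • n)) : ℝ) : ℂ) := by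
    -- Glimm–Jaffe §6.1: one-mirror lemma in the directions `(1,1)`, `(0,1)` + diagonal local cross
    intro n hnmem hg
    have hn : n ≠ 0 := ne_zero_of_mem_latticeMirrorNormals hnmem
    have hH := halfPlaneHolomorphy_of_inPlaneLightCone hIP hnmem
    have hgood' := hgood hg
    set i₀ : Fin (m + 1) := 0 with hi₀def
    set c : ℝ := ⟪z₀ i₀, n⟫_ℝ with hc
    set J : Finset (Fin (m + 1)) := Finset.univ.filter fun j => c < ⟪z₀ j, n⟫_ℝ with hJ
    set J₀ : Finset (Fin (m + 1)) := Finset.univ.filter fun j => c ≤ ⟪z₀ j, n⟫_ℝ with hJ₀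
    have hmJ : ∀ j, j ∈ J ↔ c < ⟪z₀ j, n⟫_ℝ := fun j => by simp [hJ]
    have hmJ₀ : ∀ j, j ∈ J₀ ↔ c ≤ ⟪z₀ j, n⟫_ℝ := fun j => by simp [hJ₀]
    have h0J : i₀ ∉ J := by rw [hmJ]; exact lt_irrefl _
    have h0J₀ : i₀ ∈ J₀ := by rw [hmJ₀]
    have hJJ₀ : ∀ j, j ≠ i₀ → (j ∈ J₀ ↔ j ∈ J) := fun j hj => by
      rw [hmJ, hmJ₀]
      exact ⟨fun h => lt_of_le_of_ne h (hgood' j hj).symm, le_of_lt⟩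
    -- the two gaps
    obtain ⟨g₁, hg₁, hgap₁⟩ : ∃ g > 0, ∀ j, j ∉ J₀ → ⟪z₀ j, n⟫_ℝ < c - g :=
      margin_lt fun j hj => by rwa [hmJ₀, not_le] at hj
    obtain ⟨g₂, hg₂, hgap₂⟩ : ∃ g > 0, ∀ j, j ∈ J → c + g < ⟪z₀ j, n⟫_ℝ :=
      margin_gt fun j hj => by rwa [hmJ] at hj
    -- the one-mirror lemma for `J₀` (mirror between the lower points and `z₀ i₀`)
    obtain ⟨ρ₁, hρ₁, M₁, hE₁⟩ := eventually_exists_halfPlane_extension_slabShift hn hperm htr hcont hH J₀ hz₀inj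
      (h₀ := c - g₁ / 2) (τ := g₁ / 4) (by positivity)
      (fun i hi => by linarith [hgap₁ i hi])
      (fun i hi => by have := (hmJ₀ i).1 hi; linarith)
    -- the one-mirror lemma for `J` (mirror between `z₀ i₀` and the upper points)
    obtain ⟨ρ₂, hρ₂, M₂, hE₂⟩ := eventually_exists_halfPlane_extension_slabShift hn hperm htr hcont hH J hz₀inj
      (h₀ := c + g₂ / 2) (τ := g₂ / 4) (by positivity)
      (fun i hi => by have := (not_lt.1 (mt (hmJ i).2 hi)); linarith)
      (fun i hi => by linarith [hgap₂ i hi])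
    obtain ⟨ε, hε, hball⟩ := Metric.eventually_nhds_iff.1 (hE₁.and hE₂)
    -- scales
    have hnpos : 0 < ‖n‖ := norm_pos_iff.2 hn
    set ℓ₀ : ℝ := ε / (4 * ‖n‖) with hℓ₀
    have hℓ₀pos : 0 < ℓ₀ := by positivity
    set ℓ : ℝ := min ℓ₀ (min ρ₁ ρ₂) with hℓdef
    have hℓ : 0 < ℓ := lt_min hℓ₀pos (lt_min hρ₁ hρ₂)
    have hℓ₁ : ℓ ≤ ρ₁ := (min_le_right _ _).trans (min_le_left _ _)
    have hℓ₂ : ℓ ≤ ρ₂ := (min_le_right _ _).trans (min_le_right _ _)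
    have hℓℓ₀ : ℓ ≤ ℓ₀ := min_le_left _ _
    obtain ⟨r, hr, hcross⟩ := exists_holomorphic_extension_diagonal_of_separately_two_local ℓ hℓ
    -- the shifted configurations stay in the good ball
    have hnear : ∀ z : Fin (m + 1) → EuclideanSpace ℝ (Fin 3), dist z z₀ < ε / 2 → ∀ u v : ℝ, |u| < ℓ →
        |v| < ℓ → dist (fun j => z j + (if j ∈ J₀ then u else 0) • n + (if j ∈ J then v else 0) • n)
          z₀ < ε := by
      intro z hz u v hu hv
      have h1 := dist_shift (n := n) J₀ J z u v
      have h2 : (|u| + |v|) * ‖n‖ < ε / 2 := by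
        have : |u| + |v| < 2 * ℓ₀ := by linarith
        calc (|u| + |v|) * ‖n‖ < 2 * ℓ₀ * ‖n‖ := by gcongr
          _ = ε / 2 := by rw [hℓ₀]; field_simp; ring
      calc dist _ z₀ ≤ dist _ z + dist z z₀ := dist_triangle _ _ _
        _ < ε / 2 + ε / 2 := by linarith
        _ = ε := by ring
    -- a disc inside a half-plane
    have hdisc : ∀ {ρ : ℝ}, ℓ ≤ ρ → ball (0 : ℂ) ℓ ⊆ {w : ℂ | -ρ < w.re} := fun hρ w hw => by
      rw [mem_ball_zero_iff] at hw
      have := Complex.abs_re_le_norm w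
      simp only [mem_setOf_eq]
      linarith [(abs_lt.1 (this.trans_lt hw)).1]
    refine ⟨r, hr, max M₁ M₂, ?_⟩
    have hmem : ball z₀ (ε / 2) ∈ 𝓝 z₀ := ball_mem_nhds _ (by positivity)
    filter_upwards [hmem] with z hz
    rw [mem_ball] at hz
    -- the two-parameter function
    set H : ℝ → ℝ → ℂ := fun u v =>
      ((S (m + 1) (fun j => z j + (if j ∈ J₀ then u else 0) • n + (if j ∈ J then v else 0) • n) : ℝ) : ℂ)
      with hHdef
    obtain ⟨g, hgd, hgb, hgr⟩ := hcross (max M₁ M₂) H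
      (fun v hv => by
        -- slices in `u`: the one-mirror lemma for `J₀` at the configuration shifted by `v·1_J n`
        have hgoodv := (hball (hnear z hz 0 v (by simpa using hℓ) hv)).1
        simp only [ite_self, zero_smul, add_zero] at hgoodv
        obtain ⟨Φ, hΦd, hΦr, hΦb⟩ := hgoodv
        refine ⟨Φ, hΦd.mono (hdisc hℓ₁), fun w hw => (hΦb w (hdisc hℓ₁ hw)).trans (le_max_left _ _),
          fun u hu => ?_⟩
        rw [hΦr u (by linarith [(abs_lt.1 hu).1]), hHdef]
        dsimp only
        congr 2
        funext j
        rw [add_right_comm])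
      (fun u hu => by
        -- slices in `v`: the one-mirror lemma for `J` at the configuration shifted by `u·1_{J₀} n`
        have hgoodu := (hball (hnear z hz u 0 hu (by simpa using hℓ))).2
        simp only [ite_self, zero_smul, add_zero] at hgoodu
        obtain ⟨Φ, hΦd, hΦr, hΦb⟩ := hgoodu
        refine ⟨Φ, hΦd.mono (hdisc hℓ₂), fun w hw => (hΦb w (hdisc hℓ₂ hw)).trans (le_max_right _ _),
          fun v hv => ?_⟩
        rw [hΦr v (by linarith [(abs_lt.1 hv).1]), hHdef])
    refine ⟨g, hgd, hgb, fun t ht => ?_⟩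
    rw [hgr t ht, hHdef]
    dsimp only
    congr 2
    funext j
    by_cases hj : j = i₀
    · subst hj
      rw [Function.update_self, if_pos h0J₀, if_neg h0J, zero_smul, add_zero]
    · rw [Function.update_of_ne hj]
      by_cases hjJ : j ∈ J
      · rw [if_pos hjJ, if_pos ((hJJ₀ j hj).2 hjJ), neg_smul, add_neg_cancel_right]
      · rw [if_neg hjJ, if_neg (mt (hJJ₀ j hj).1 hjJ), zero_smul, add_zero, add_zero]

  obtain ⟨r₁, hr₁, M₁, hE₁⟩ := hdir hn₁ hg₁
  obtain ⟨r₂, hr₂, M₂, hE₂⟩ := hdir hn₂ hg₂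
  obtain ⟨r₃, hr₃, M₃, hE₃⟩ := hdir hn₃ hg₃
  obtain ⟨ε, hε, hball⟩ := Metric.eventually_nhds_iff.1 (hE₁.and (hE₂.and hE₃))
  -- the three-parameter family of configurations stays in the good ball
  set K : ℝ := ‖n₁‖ + ‖n₂‖ + ‖n₃‖ + 1 with hK
  have hKpos : 0 < K := by positivity
  set δ : ℝ := ε / (2 * K) with hδ
  have hδpos : 0 < δ := by positivity
  have hcfg : ∀ t₁ t₂ t₃ : ℝ, |t₁| < δ → |t₂| < δ → |t₃| < δ →
      dist (Fin.cons (x + t₁ • n₁ + t₂ • n₂ + t₃ • n₃) y : Fin (m + 1) → EuclideanSpace ℝ (Fin 3))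
        z₀ < ε := by
    intro t₁ t₂ t₃ h₁ h₂ h₃
    have hle : dist (Fin.cons (x + t₁ • n₁ + t₂ • n₂ + t₃ • n₃) y :
        Fin (m + 1) → EuclideanSpace ℝ (Fin 3)) z₀ ≤ δ * (‖n₁‖ + ‖n₂‖ + ‖n₃‖) := by
      refine (dist_pi_le_iff (by positivity)).2 fun j => ?_
      refine Fin.cases ?_ (fun i => ?_) j
      · simp only [hz₀, Fin.cons_zero, dist_eq_norm]
        rw [show x + t₁ • n₁ + t₂ • n₂ + t₃ • n₃ - x = t₁ • n₁ + t₂ • n₂ + t₃ • n₃ by abel]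
        calc ‖t₁ • n₁ + t₂ • n₂ + t₃ • n₃‖ ≤ ‖t₁ • n₁‖ + ‖t₂ • n₂‖ + ‖t₃ • n₃‖ := norm_add₃_le
          _ = |t₁| * ‖n₁‖ + |t₂| * ‖n₂‖ + |t₃| * ‖n₃‖ := by
              simp only [norm_smul, Real.norm_eq_abs]
          _ ≤ δ * ‖n₁‖ + δ * ‖n₂‖ + δ * ‖n₃‖ := by gcongr
          _ = δ * (‖n₁‖ + ‖n₂‖ + ‖n₃‖) := by ring
      · simp only [hz₀, Fin.cons_succ, dist_self]
        positivity
    calc _ ≤ δ * (‖n₁‖ + ‖n₂‖ + ‖n₃‖) := hle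
      _ < δ * K := by rw [hK]; exact mul_lt_mul_of_pos_left (by linarith) hδpos
      _ = ε / 2 := by rw [hδ]; field_simp
      _ < ε := by linarith
  -- the three-variable function and its slices
  set P : ℝ → ℝ → ℝ → ℂ := fun t₁ t₂ t₃ =>
    ((S (m + 1) (Fin.cons (x + t₁ • n₁ + t₂ • n₂ + t₃ • n₃) y) : ℝ) : ℂ) with hP
  set ℓ : ℝ := min δ (min r₁ (min r₂ r₃)) with hℓdef
  have hℓ : 0 < ℓ := lt_min hδpos (lt_min hr₁ (lt_min hr₂ hr₃))
  have hℓδ : ℓ ≤ δ := min_le_left _ _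
  have hℓ₁ : ℓ ≤ r₁ := (min_le_right _ _).trans (min_le_left _ _)
  have hℓ₂ : ℓ ≤ r₂ := (min_le_right _ _).trans ((min_le_right _ _).trans (min_le_left _ _))
  have hℓ₃ : ℓ ≤ r₃ := (min_le_right _ _).trans ((min_le_right _ _).trans (min_le_right _ _))
  obtain ⟨r, hr, hcross⟩ := exists_holomorphic_extension_of_separately_three_local ℓ hℓ
  have hupd : ∀ (p : EuclideanSpace ℝ (Fin 3)) (t : ℝ) (n : EuclideanSpace ℝ (Fin 3)),
      Function.update (Fin.cons p y : Fin (m + 1) → EuclideanSpace ℝ (Fin 3)) 0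
        ((Fin.cons p y : Fin (m + 1) → EuclideanSpace ℝ (Fin 3)) 0 + t • n) = Fin.cons (p + t • n) y :=
    fun p t n => by rw [Fin.cons_zero, Fin.update_cons_zero]
  obtain ⟨G, hGd, -, hGr⟩ := hcross (max M₁ (max M₂ M₃)) P
    (fun t₂ t₃ h₂ h₃ => by
      obtain ⟨⟨g, hgd, hgb, hgr⟩, -, -⟩ := hball (hcfg 0 t₂ t₃ (by simpa using hδpos)
        (h₂.trans_le hℓδ) (h₃.trans_le hℓδ))
      refine ⟨g, hgd.mono (ball_subset_ball hℓ₁), fun w hw => (hgb w (ball_subset_ball hℓ₁ hw)).trans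
        (le_max_left _ _), fun t₁ h₁ => ?_⟩
      rw [hgr t₁ (h₁.trans_le hℓ₁), hupd, hP]
      simp only [zero_smul, add_zero]
      congr 3
      abel)
    (fun t₁ t₃ h₁ h₃ => by
      obtain ⟨-, ⟨g, hgd, hgb, hgr⟩, -⟩ := hball (hcfg t₁ 0 t₃ (h₁.trans_le hℓδ) (by simpa using hδpos)
        (h₃.trans_le hℓδ))
      refine ⟨g, hgd.mono (ball_subset_ball hℓ₂), fun w hw => (hgb w (ball_subset_ball hℓ₂ hw)).trans
        ((le_max_left _ _).trans (le_max_right _ _)), fun t₂ h₂ => ?_⟩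
      rw [hgr t₂ (h₂.trans_le hℓ₂), hupd, hP]
      simp only [zero_smul, add_zero]
      congr 3
      abel)
    (fun t₁ t₂ h₁ h₂ => by
      obtain ⟨-, -, ⟨g, hgd, hgb, hgr⟩⟩ := hball (hcfg t₁ t₂ 0 (h₁.trans_le hℓδ) (h₂.trans_le hℓδ)
        (by simpa using hδpos))
      refine ⟨g, hgd.mono (ball_subset_ball hℓ₃), fun w hw => (hgb w (ball_subset_ball hℓ₃ hw)).trans
        ((le_max_right _ _).trans (le_max_right _ _)), fun t₃ h₃ => ?_⟩
      rw [hgr t₃ (h₃.trans_le hℓ₃), hupd, hP]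
      simp only [zero_smul, add_zero])
  -- conclude with the chart lemma for the basis `n₁, n₂, n₃`
  have hcard : Fintype.card (Fin 3) = Module.finrank ℝ (EuclideanSpace ℝ (Fin 3)) := by simp
  set b := basisOfLinearIndependentOfCardEqFinrank hli hcard with hb
  have hbv : ∀ k, b k = ![n₁, n₂, n₃] k := fun k => by
    rw [hb, coe_basisOfLinearIndependentOfCardEqFinrank]
  exact analyticAt_of_holomorphic_chart (f := fun x' => S (m + 1) (Fin.cons x' y)) b hr hGd
    (fun t₁ t₂ t₃ h₁ h₂ h₃ => by
      rw [hGr t₁ t₂ t₃ h₁ h₂ h₃, hP, hbv, hbv, hbv]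
      simp only [Matrix.cons_val_zero, Matrix.cons_val_one, Matrix.cons_val])

end Summit.CriticalPhenomena.Ising3DConformalLimit.Cruxes.RotationUpgradeFromTwoPoint.NullLaplacianEdgeGaussianity

end
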